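import Summits.ResolutionOfSingularities.ResolutionOfSingularities.Theses.SectionAscent
import Summits.ResolutionOfSingularities.ResolutionOfSingularities.Theorems.WeightedInvariantWeightedThesisProjectiveIntegralSuffices
import Summits.ResolutionOfSingularities.ResolutionOfSingularities.Theorems.PAlterationPicoverLocalBlowups
import Summits.ResolutionOfSingularities.ResolutionOfSingularities.Theorems.SectionAscentAffineToGlobalLocalModel
import Summits.ResolutionOfSingularities.ResolutionOfSingularities.Theorems.SectionAscentAffineToGlobalIdealExtension
import Literature.AlgebraicGeometry.Resolution.Blowups
import Literature.AlgebraicGeometry.Resolution.BlowupsExistence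
import Literature.AlgebraicGeometry.Resolution.BlowupsFlatBaseChange
import Literature.AlgebraicGeometry.Resolution.Temkin2008Localization
import HarnessLib

/-!
# Crux `AffineToGlobal` (stmt-ResolutionOfSingularities-15961), line `birth`: the TRUE half —
# one-shots on modifications of affine varieties patch to resolutions (Temkin's localisation)

Route `ResolutionOfSingularities/SectionAscent`, crux `AffineToGlobal`
(`Summit.ResolutionOfSingularities.ResolutionOfSingularities.Theses.SectionAscent.AffineToGlobal`:
affine strong one-shot resolutions in characteristic `p`, all dimensions ⇒ `ResolutionInChar p`),
line `birth`, lead's skeleton `Cruxes/AffineToGlobal/Lines/birth.lean`. Support file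
(`--supports stmt-ResolutionOfSingularities-15961`): the birth skeleton's stub
`stub_modificationPatching` ("one-shots on modifications of affine varieties in characteristic
`p` ⇒ every integral closed `X ⊆ ℙⁿ_K`, `char K = p`, has a resolution") PROVED, and the crux
REDUCED to the single open stub `stub_affineToModification` (`affineToGlobal_of_affineToModification`).

**Proof (Temkin 2008, Prop. 2.3.4 (iii)⇒(ii), as formalized in the tree).** By the per-scheme
Temkin localisation over a field
(`Theorems.Picover.LocalBlowups.admitsDesingularization_of_localBlowups_over_field`, from
`temkin2008_prop234_of_comp`: Noetherian induction over the closed subset of `X` over which the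
current `Sing`-supported blow-up is still singular), an integral `X` of finite type over `K`
admits a desingularization as soon as every blow-up `S'` of every local scheme `Spec 𝒪_{X,x}`
admits one (`localOneShot`). For that: pick an affine open `U ∋ x`; `Γ(X, U)` is an integral
`K`-algebra of finite type and `Spec 𝒪_{X,x} → Spec Γ(X, U)` is a flat preimmersion (a
localization); the blown-up ideal sheaf is extended from a non-zero ideal sheaf `J₀` on
`Spec Γ(X, U)` (`IdealExtension.stub_idealExtension`); the hypothesis hands a one-shot ideal `J`
to the blow-up `W → Spec Γ(X, U)` along `J₀`; and `LocalModel.stub_localModel` (blow-ups commute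
with flat base change; flat preimmersions identify local rings) desingularizes `S'`. A
desingularization of an integral scheme of finite type over a field is a resolution
(`Scheme.AdmitsDesingularization.hasResolution`), and a closed subscheme of `ℙⁿ_K` is of finite
type over `K`. Finally the landed projective reduction
`Theorems.WeightedThesis.ProjectiveIntegralSuffices.stub_projectiveIntegralSuffices` turns
resolutions of integral closed subschemes of projective spaces into the `ResolutionInChar p`
clause, whence the crux from `stub_affineToModification` alone.

## Sources

* M. Temkin, *Desingularization of quasi-excellent schemes in characteristic zero*, Adv. Math.
  219 (2008), Prop. 2.3.4 and its proof (arXiv p. 12), Lemma 2.1.1. [Temkin2008]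
* U. Görtz, T. Wedhorn, *Algebraic Geometry I*, 2nd ed. (2020), Prop. 13.91 (2). [GortzWedhorn2020]
* V. Cossart, O. Piltant, J. Algebra 529 (2019), Prop. 4.6 (proof, Steps 1–3). [CossartPiltant2019]
-/

noncomputable section

set_option linter.dupNamespace false -- mandated namespace of this single-conjunct summit

open CategoryTheory CategoryTheory.Limits AlgebraicGeometry Literature.AlgebraicGeometry.Resolution

namespace Summit.ResolutionOfSingularities.ResolutionOfSingularities.Theorems.AffineToGlobal.ModificationPatching

/-- **Local one-shot desingularization from one-shots on modifications of affine varieties.**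
If for every integral finite-type `K`-algebra `A` (`char K = p`) every blow-up `W → Spec A` along
a non-zero ideal sheaf carries an ideal sheaf co-supported exactly on its non-regular points all
of whose blow-ups are regular, then for every integral `X` of finite type over `K`, every
`x ∈ X` and every blow-up `S'` of `Spec 𝒪_{X,x}`, the scheme `S'` admits a desingularization.
Proof: affine open `U ∋ x`; `Γ(X, U)` is an integral `K`-algebra of finite type;
`Spec 𝒪_{X,x} → Spec Γ(X, U)` is a flat preimmersion (a localization); the centre is extended
from `Spec Γ(X, U)` (`IdealExtension.stub_idealExtension`); apply the hypothesis to the blow-up of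
`Spec Γ(X, U)` along the extension and `LocalModel.stub_localModel`.
[cite: Temkin2008, Prop. 2.3.4 (proof)] -/
theorem localOneShot (p : ℕ)
    (h : ∀ (K : Type) [Field K] [CharP K p] (A : Type) [CommRing A] [IsDomain A] [Algebra K A]
      [Algebra.FiniteType K A] (W : Scheme.{0}) (g : W ⟶ Spec (.of A))
      (J₀ : (Spec (.of A)).IdealSheafData), J₀ ≠ ⊥ → IsBlowup g J₀ →
      ∃ J : W.IdealSheafData, J ≠ ⊥ ∧
        (∀ w : W, w ∈ J.support ↔ ¬ IsRegularLocalRing (W.presheaf.stalk w)) ∧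
        ∀ (W' : Scheme.{0}) (ρ : W' ⟶ W), IsBlowup ρ J → Scheme.IsRegular W')
    (K : Type) [Field K] [CharP K p] (X : Scheme.{0}) [IsIntegral X] (f : X ⟶ Spec (.of K))
    [LocallyOfFiniteType f] [QuasiCompact f] (x : X) (S' : Scheme.{0})
    (g : S' ⟶ Spec (X.presheaf.stalk x)) (I : (Spec (X.presheaf.stalk x)).IdealSheafData)
    (hg : IsBlowup g I) : Scheme.AdmitsDesingularization S' := by
  by_cases hI : I = ⊥
  · subst hI
    haveI := hg.isEmpty_of_bot
    exact Scheme.admitsDesingularization_of_isEmpty S'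
  obtain ⟨U, hU, hxU, -⟩ :=
    exists_isAffineOpen_mem_and_subset (X := X) (x := x) (U := ⊤) trivial
  obtain ⟨J₀, hJ₀, hJ₀I⟩ := IdealExtension.stub_idealExtension X U hU x hxU I hI
  -- `Γ(X, U)` is an integral `K`-algebra of finite type
  haveI : Nonempty U := ⟨⟨x, hxU⟩⟩
  haveI : IsDomain Γ(X, U) := IsIntegral.component_integral U
  letI : Algebra K Γ(X, U) :=
    ((f.appLE ⊤ U le_top).hom.comp (Scheme.ΓSpecIso (.of K)).inv.hom).toAlgebra
  haveI : Algebra.FiniteType K Γ(X, U) := by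
    have hft : RingHom.FiniteType (f.appLE ⊤ U le_top).hom :=
      HasRingHomProperty.appLE @LocallyOfFiniteType f inferInstance ⟨⊤, isAffineOpen_top _⟩
        ⟨U, hU⟩ le_top
    exact hft.comp (RingHom.FiniteType.of_surjective _
      (Scheme.ΓSpecIso (.of K)).commRingCatIsoToRingEquiv.symm.surjective)
  -- `Spec 𝒪_{X,x} → Spec Γ(X, U)` is a flat preimmersion (a localization)
  letI algA : Algebra Γ(X, U) (X.presheaf.stalk x) := (X.presheaf.germ U x hxU).hom.toAlgebra
  have hloc : IsLocalization.AtPrime (X.presheaf.stalk x) (hU.primeIdealOf ⟨x, hxU⟩).asIdeal :=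
    hU.isLocalization_stalk ⟨x, hxU⟩
  haveI : Flat (Spec.map (X.presheaf.germ U x hxU)) := by
    rw [Flat.SpecMap_iff]
    have : Module.Flat Γ(X, U) (X.presheaf.stalk x) :=
      IsLocalization.flat (X.presheaf.stalk x) (hU.primeIdealOf ⟨x, hxU⟩).asIdeal.primeCompl
    exact RingHom.flat_algebraMap_iff.mpr this
  haveI : IsPreimmersion (Spec.map (X.presheaf.germ U x hxU)) :=
    IsPreimmersion.of_isLocalization (R := Γ(X, U)) (S := X.presheaf.stalk x)
      (hU.primeIdealOf ⟨x, hxU⟩).asIdeal.primeCompl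
  -- the blow-up of `Spec Γ(X, U)` along `J₀` and its one-shot ideal
  obtain ⟨W, π, hπ⟩ := exists_isBlowup (Spec Γ(X, U)) J₀
  obtain ⟨J, -, hsupp, hreg⟩ := h K Γ(X, U) W π J₀ hJ₀ hπ
  rw [← hJ₀I] at hg
  exact LocalModel.stub_localModel (Spec Γ(X, U)) (Spec (X.presheaf.stalk x))
    (Spec.map (X.presheaf.germ U x hxU)) W π J₀ hπ J (fun w hw => (hsupp w).mp hw) hreg S' g hg

/-- **`stub_modificationPatching` of the birth skeleton, PROVED** (registered signature of the
birth skeleton with its hypothesis `ModificationOneShot p` and conclusion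
`ProjectiveIntegralResolvable p` written out): one-shots on modifications of affine varieties in
characteristic `p` ⇒ every integral closed subscheme of every `ℙⁿ_K`, `char K = p`, has a
resolution of singularities. Proof: local one-shots (`localOneShot`) feed the in-tree Temkin
localisation `Theorems.Picover.LocalBlowups.admitsDesingularization_of_localBlowups_over_field`;
a desingularization of an integral scheme of finite type over a field is a resolution
(`Scheme.AdmitsDesingularization.hasResolution`); `ℙⁿ_K → Spec K` is proper, so a closed
subscheme of `ℙⁿ_K` is of finite type over `K`. [cite: Temkin2008, Prop. 2.3.4] -/
theorem stub_modificationPatching (p : ℕ) (hp : p.Prime)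
    (h : ∀ (K : Type) [Field K] [CharP K p] (A : Type) [CommRing A] [IsDomain A] [Algebra K A]
      [Algebra.FiniteType K A] (W : Scheme.{0}) (g : W ⟶ Spec (.of A))
      (J₀ : (Spec (.of A)).IdealSheafData), J₀ ≠ ⊥ → IsBlowup g J₀ →
      ∃ J : W.IdealSheafData, J ≠ ⊥ ∧
        (∀ w : W, w ∈ J.support ↔ ¬ IsRegularLocalRing (W.presheaf.stalk w)) ∧
        ∀ (W' : Scheme.{0}) (ρ : W' ⟶ W), IsBlowup ρ J → Scheme.IsRegular W')
    (K : Type) [Field K] [CharP K p] (n : ℕ) (X : Scheme.{0})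
    (ι : X ⟶ (Literature.AlgebraicGeometry.Motives.projectiveSpace n K).left)
    (hι : IsClosedImmersion ι) (hX : IsIntegral X) : Scheme.HasResolution X := by
  have _ := hp
  haveI := hι
  haveI := hX
  haveI : IsProper (Literature.AlgebraicGeometry.Motives.projectiveSpace n K).hom :=
    Literature.AlgebraicGeometry.Motives.isProper_projectiveSpace n K
  let f : X ⟶ Spec (.of K) := ι ≫ (Literature.AlgebraicGeometry.Motives.projectiveSpace n K).hom
  haveI : LocallyOfFiniteType f := inferInstance
  haveI : QuasiCompact f := inferInstance
  have hdes : Scheme.AdmitsDesingularization X :=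
    Theorems.Picover.LocalBlowups.admitsDesingularization_of_localBlowups_over_field K X f
      (fun x _ S' g I hg _ => localOneShot p h K X f x S' g I hg)
  haveI : IsLocallyNoetherian X := LocallyOfFiniteType.isLocallyNoetherian f
  exact hdes.hasResolution

/-- **Resolution in characteristic `p` from one-shots on modifications of affine varieties**
(the local-to-global statement of this line in its final form): if for every field `K` of
characteristic `p`, every integral finite-type `K`-algebra `A` and every blow-up `W → Spec A`
along a non-zero ideal sheaf there is an ideal sheaf on `W` co-supported exactly on the
non-regular points all of whose blow-ups are regular, then every reduced separated scheme of
finite type over every field of characteristic `p` has a resolution of singularities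
(`ResolutionInChar p`): `stub_modificationPatching` followed by the landed projective reduction
`stub_projectiveIntegralSuffices`. [cite: Temkin2008, Prop. 2.3.4; CossartPiltant2019, Prop. 4.6] -/
theorem resolutionInChar_of_modificationOneShot (p : ℕ) (hp : p.Prime)
    (h : ∀ (K : Type) [Field K] [CharP K p] (A : Type) [CommRing A] [IsDomain A] [Algebra K A]
      [Algebra.FiniteType K A] (W : Scheme.{0}) (g : W ⟶ Spec (.of A))
      (J₀ : (Spec (.of A)).IdealSheafData), J₀ ≠ ⊥ → IsBlowup g J₀ →
      ∃ J : W.IdealSheafData, J ≠ ⊥ ∧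
        (∀ w : W, w ∈ J.support ↔ ¬ IsRegularLocalRing (W.presheaf.stalk w)) ∧
        ∀ (W' : Scheme.{0}) (ρ : W' ⟶ W), IsBlowup ρ J → Scheme.IsRegular W') :
    ResolutionInChar.{0} p :=
  fun k _ _ X f hsep hlft hqc hred =>
    Theorems.WeightedThesis.ProjectiveIntegralSuffices.stub_projectiveIntegralSuffices k
      (fun n Y ι hι hint => stub_modificationPatching p hp h k n Y ι hι hint) X f hsep hlft hqc hred

/-- **Resolution in characteristic `p` from LOCAL desingularizations** — the weakest hypothesis
the patching consumes (Temkin's condition (iii) of Prop. 2.3.4 over fields of characteristic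
`p`, at singular points only): if for every integral `X` of finite type over a field of
characteristic `p`, every singular point `x ∈ X` and every blow-up `S'` of `Spec 𝒪_{X,x}`
whose singular points lie over the closed point, `S'` admits a desingularization, then
`ResolutionInChar p` holds. Proof: per-scheme Temkin localisation over a field
(`Theorems.Picover.LocalBlowups.admitsDesingularization_of_localBlowups_over_field`),
desingularizations are resolutions, and the projective integral case suffices
(`stub_projectiveIntegralSuffices`). [cite: Temkin2008, Prop. 2.3.4] -/
theorem resolutionInChar_of_localDesingularization (p : ℕ)
    (h : ∀ (K : Type) [Field K] [CharP K p] (X : Scheme.{0}) [IsIntegral X]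
      (f : X ⟶ Spec (.of K)) [LocallyOfFiniteType f] [QuasiCompact f] (x : X),
      x ∉ Scheme.regularLocus X →
      ∀ (S' : Scheme.{0}) (g : S' ⟶ Spec (X.presheaf.stalk x))
        (I : (Spec (X.presheaf.stalk x)).IdealSheafData), IsBlowup g I →
        (∀ s : S', s ∉ Scheme.regularLocus S' →
          g s = IsLocalRing.closedPoint (X.presheaf.stalk x)) →
        Scheme.AdmitsDesingularization S') :
    ResolutionInChar.{0} p := by
  intro k _ _ X f hsep hlft hqc hred
  refine Theorems.WeightedThesis.ProjectiveIntegralSuffices.stub_projectiveIntegralSuffices k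
    (fun n Y ι hι hint => ?_) X f hsep hlft hqc hred
  haveI := hι
  haveI := hint
  haveI : IsProper (Literature.AlgebraicGeometry.Motives.projectiveSpace n k).hom :=
    Literature.AlgebraicGeometry.Motives.isProper_projectiveSpace n k
  let fY : Y ⟶ Spec (.of k) := ι ≫ (Literature.AlgebraicGeometry.Motives.projectiveSpace n k).hom
  haveI : LocallyOfFiniteType fY := inferInstance
  haveI : QuasiCompact fY := inferInstance
  have hdes : Scheme.AdmitsDesingularization Y :=
    Theorems.Picover.LocalBlowups.admitsDesingularization_of_localBlowups_over_field k Y fY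
      (fun y hy S' g I hg hs => h k Y fY y hy S' g I hg hs)
  haveI : IsLocallyNoetherian Y := LocallyOfFiniteType.isLocallyNoetherian fY
  exact hdes.hasResolution

/-- **The crux `AffineToGlobal` reduced to the single open stub `stub_affineToModification`**
(the line `birth` in its landed shape): if, prime by prime, affine one-shots in all dimensions
(`∀ d, OneShot p d`, the crux's hypothesis) imply one-shots on all modifications of affine
varieties, then `SectionAscent.AffineToGlobal` holds — by `stub_modificationPatching` and the
landed projective reduction `stub_projectiveIntegralSuffices`. This is a CONDITIONAL result: its
hypothesis is the registered stub `stub_affineToModification` of the skeleton, the crux's open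
content (non-canonical chartwise one-shots need not glue, Cossart–Piltant 2019, p. 3).
[cite: CossartPiltant2019, Prop. 4.6 (proof, Steps 1–3) and p. 3] -/
theorem affineToGlobal_of_affineToModification
    (h₁ : ∀ p : ℕ, p.Prime →
      (∀ d : ℕ, ∀ (K : Type) [Field K] [CharP K p] (A : Type) [CommRing A] [IsDomain A]
        [Algebra K A] [Algebra.FiniteType K A], ringKrullDim A < (d : WithBot ℕ∞) →
        ∃ I : Ideal A, I ≠ ⊥ ∧
          Literature.AlgebraicGeometry.Resolution.Scheme.IsRegular
            (Literature.AlgebraicGeometry.Resolution.affineBlowup I) ∧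
          ∀ 𝔭 : PrimeSpectrum A, I ≤ 𝔭.asIdeal ↔
            ¬ IsRegularLocalRing (Localization.AtPrime 𝔭.asIdeal)) →
      ∀ (K : Type) [Field K] [CharP K p] (A : Type) [CommRing A] [IsDomain A] [Algebra K A]
        [Algebra.FiniteType K A] (W : Scheme.{0}) (g : W ⟶ Spec (.of A))
        (J₀ : (Spec (.of A)).IdealSheafData), J₀ ≠ ⊥ → IsBlowup g J₀ →
        ∃ J : W.IdealSheafData, J ≠ ⊥ ∧
          (∀ w : W, w ∈ J.support ↔ ¬ IsRegularLocalRing (W.presheaf.stalk w)) ∧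
          ∀ (W' : Scheme.{0}) (ρ : W' ⟶ W), IsBlowup ρ J → Scheme.IsRegular W') :
    Summit.ResolutionOfSingularities.ResolutionOfSingularities.Theses.SectionAscent.AffineToGlobal :=
  fun p hp hOne k _ _ X f hsep hlft hqc hred =>
    Theorems.WeightedThesis.ProjectiveIntegralSuffices.stub_projectiveIntegralSuffices k
      (fun n Y ι hι hint => stub_modificationPatching p hp (h₁ p hp hOne) k n Y ι hι hint)
      X f hsep hlft hqc hred

end Summit.ResolutionOfSingularities.ResolutionOfSingularities.Theorems.AffineToGlobal.ModificationPatching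

end
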